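import Literature.Probability.LatticeModels.PlaneRotatorAizenmanSimonWindow
import Literature.Probability.LatticeModels.PlaneRotatorStiffnessHighTemperatureLieb
import Literature.Probability.LatticeModels.PlaneRotatorPeriodicSusceptibility
import Literature.Probability.LatticeModels.PlaneRotatorWiredPairEnergyBound
import Literature.MathematicalPhysics.StatisticalMechanics.KosterlitzThoulessStiffnessBound
import Mathlib.Topology.Algebra.Order.LiminfLimsup
import HarnessLib

/-!
# The infinite-volume stiffness `Υ_∞(K) := liminf_{L→∞} βΥ_L(K)` of the two-dimensional plane rotator,
# and the cell's stiffness sentences restated on it without a finite-volume window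

Topic `Literature/Probability/LatticeModels`. The tree's helicity modulus of the nearest-neighbour plane rotator
is a FINITE-VOLUME object, the reduced modulus `βΥ_L(K)` of the torus `(ℤ/Lℤ)²` (`torusXYStiffness L K`,
M. E. Fisher, M. N. Barber, D. Jasnow, Phys. Rev. A **8** (1973) 1111 [FisherBarberJasnow1973], §II eqs.
(2.4)–(2.5)); every thermodynamic statement about it in the tree (`tendsto_torusXYStiffness_of_…`, the
Kosterlitz–Thouless corollaries `kt_le_…_of_pos_below` / `…_of_stableBelow_of_tendsto_torusXYStiffness`)
therefore carries a WINDOW hypothesis "along sizes `L_n → ∞` the moduli `T·βΥ_{L_n}(J/T)` converge to `ρ(T)`".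
Fisher–Barber–Jasnow's thermodynamic helicity modulus is the `L → ∞` limit (eq. (2.5)); its existence for the
plane rotator is not known in general, but the LOWER ENVELOPE always exists:

* `torusXYStiffnessLiminf K` — **`Υ_∞(K) := liminf_{L→∞} βΥ_{L+1}(K)`** (the ONE definition of this file).

Everything else is PROVED, by name from the tree:

* (α) `torusXYStiffnessLiminf_nonneg`, `torusXYStiffnessLiminf_le_coupling`, `torusXYStiffnessLiminf_le`
  (`0 ≤ Υ_∞(K) ≤ K` and `Υ_∞(K) ≤ 8K²/(1+8K)`, from the finite-`L` floor `torusXYStiffness_nonneg`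
  (Ginibre) and ceilings `torusXYStiffness_le_coupling`, `torusXYStiffness_le` (f-sum × Aizenman–Simon
  equipartition)); `torusXYStiffnessLiminf_le_mul_wiredPairEnergy` (the wired ceiling `K·E^{wired}_3(K)`) and
  `torusXYStiffnessLiminf_six_sevenths_lt` (`Υ_∞(6/7) < 2/π`, certified decimal of `PlaneRotatorWiredPairEnergyBound`).
* (β) `torusXYStiffnessLiminf_eq_zero_of_tendsto` and its instances: `Υ_∞(K) = 0` for every
  `0 ≤ K < 2β_c^{Ising}(2)` (`tendsto_torusXYStiffness_of_lt_two_mul_criticalBeta_two`, Aizenman–Simon × sharpness),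
  for every `0 ≤ K < log(1+√2)` (`tendsto_torusXYStiffness_of_lt_log_one_add_sqrt_two`, Onsager), on Lieb's star
  `4u(K) < 1` (`tendsto_torusXYStiffness_lieb`), for every certified box `S_R(K) < 1`, and whenever the free
  susceptibility is finite (`tendsto_torusXYStiffness_of_summable_infTwoPoint`).
* (γ) `not_summable_infTwoPoint_of_torusXYStiffnessLiminf_pos` — **`Υ_∞(K) > 0 ⇒ χ^{2D,free}(K) = ∞`**
  (Simon–Lieb dichotomy of `PlaneRotatorFreeTwoPoint.lean` by name: the structural half `T_Υ ≤ T_χ`), with the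
  periodic twin `torus_susceptibility_unbounded_of_torusXYStiffnessLiminf_pos`, Lieb's non-terminating algorithm
  `one_le_nnBoxShellSum_of_torusXYStiffnessLiminf_pos`, sphere sums `≥ 1`, and `2β_c(2) ≤ K`.
* Temperature units: the lower-envelope thermodynamic stiffness `T ↦ T·Υ_∞(J/T)` is `≥ 0`, `≤ 8J²/(T+8J)`,
  `≤ J·E^{wired}_3(J/T)`, and `= 0` for `T > J/(2β_c(2))` (`⊇ T > J/log(1+√2) ⊇ T > 1.1346·J`).
* The Kosterlitz–Thouless corollaries WITHOUT window hypothesis: `kt_le_div_two_mul_criticalBeta_two_of_liminf_pos_below`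
  (`Υ_∞(J/T) > 0` on `(0,T_c)` ⇒ `T_c ≤ J/(2β_c(2)) ≤ J/log(1+√2) ≤ 1.1346·J`; instances for `IsTransitionAt` and
  `StableBelow` of the profile `T·Υ_∞(J/T)`), `kt_le_energy_of_stableBelow_liminf` (`T_c ≤ (√(16+4π) − 4)·J`),
  `kt_le_seven_sixths_of_stableBelow_liminf` (`T_c ≤ (7/6)·J`).
* (δ) The cell's two stiffness SENTENCES as predicates on `Υ_∞` (statement shapes, asserted nowhere, no conjecture
  filed): `StiffnessClassDecayOnLiminf K` — crux №2's `(S_Υ)`: where `Υ_∞(K) > 0`,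
  `G_K(x,y) ≤ C (1+‖x−y‖_∞)^{−1/(2π Υ_∞(K))}` — which holds VACUOUSLY wherever `Υ_∞ = 0` (the whole region where
  the tree REFUTES the finite-`L` form `torusXY_not_uniform_decay_stiffnessExponent`), so no window is needed;
  and `NelsonKosterlitzOnLiminf J T_c := StableBelow (T ↦ T·Υ_∞(J/T)) T_c` — the K2 sentence
  `βΥ ≥ 2/π below T_c`, with its consequences `T_c ≤ (7/6)·J`, `T_c ≤ 1.3448·J` by name.

Cell `pub/hubbard-tc` (MO-S3; crux №2 typing ∕ K2 register; lane `p1`, ruling R86): classical comparison model,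
number-neutral. WHAT THIS IS NOT: not `Υ_∞ > 0` anywhere (Fröhlich–Spencer), not the jump, no conjecture asserted,
not a statement about the Hubbard model.
-/

noncomputable section

open MeasureTheory Finset Filter Topology
open scoped BigOperators

namespace Literature.Probability.LatticeModels

open PlaneRotator
open Literature.MathematicalPhysics.StatisticalMechanics.KosterlitzThouless

variable [MeasurableSpace Circle] [BorelSpace Circle]

/-! ## §1 The object -/

/-- **The infinite-volume (lower-envelope) reduced stiffness of the two-dimensional plane rotator**,
`Υ_∞(K) := liminf_{L → ∞} βΥ_{L+1}(K)`, where `βΥ_L(K) = torusXYStiffness L K` is the reduced helicity modulus of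
the nearest-neighbour XY model on the torus `(ℤ/Lℤ)²` at coupling `K = βJ` (twist along `e₁`, per site). The
thermodynamic helicity modulus of Fisher–Barber–Jasnow is the `L → ∞` limit when it exists; the `liminf` always
exists and coincides with it then (`torusXYStiffnessLiminf_eq_of_tendsto`).
[cite: FisherBarberJasnow1973, §II eq. (2.5) (thermodynamic helicity modulus as the infinite-volume limit)] -/
def torusXYStiffnessLiminf (K : ℝ) : ℝ :=
  Filter.liminf (fun L : ℕ => torusXYStiffness (L + 1) K) atTop

/-! ## §2 (α) The finite-volume floor and ceilings pass to `Υ_∞` -/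

section Bounds

variable {K : ℝ}

omit [MeasurableSpace Circle] [BorelSpace Circle] in
/-- `L + 1 ≥ 3` eventually. [folklore] -/
private theorem eventually_three_le_succ : ∀ᶠ L : ℕ in atTop, 3 ≤ L + 1 := by
  filter_upwards [eventually_ge_atTop 2] with L hL
  omega

/-- The sequence `βΥ_{L+1}(K)` is bounded below by `0` (`K ≥ 0`). [cite: FisherBarberJasnow1973, §II eqs. (2.4)–(2.5); Ginibre1970 §2 Examples 2 and 4] -/
private theorem isBoundedUnder_ge_torusXYStiffness (hK : 0 ≤ K) :
    IsBoundedUnder (· ≥ ·) atTop (fun L : ℕ => torusXYStiffness (L + 1) K) :=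
  isBoundedUnder_of ⟨0, fun _ => torusXYStiffness_nonneg hK⟩

/-- The sequence `βΥ_{L+1}(K)` is bounded above by `K` (`K ≥ 0`). [cite: FisherBarberJasnow1973, §II eqs. (2.4)–(2.5)] -/
private theorem isBoundedUnder_le_torusXYStiffness (hK : 0 ≤ K) :
    IsBoundedUnder (· ≤ ·) atTop (fun L : ℕ => torusXYStiffness (L + 1) K) :=
  isBoundedUnder_of ⟨K, fun _ => torusXYStiffness_le_coupling hK⟩

/-- **If the thermodynamic limit exists it is `Υ_∞`**: `βΥ_{L+1}(K) → y ⇒ Υ_∞(K) = y`.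
[cite: FisherBarberJasnow1973, §II eq. (2.5) (thermodynamic helicity modulus)] -/
theorem torusXYStiffnessLiminf_eq_of_tendsto {y : ℝ}
    (h : Tendsto (fun L : ℕ => torusXYStiffness (L + 1) K) atTop (𝓝 y)) : torusXYStiffnessLiminf K = y :=
  h.liminf_eq

/-- **`0 ≤ Υ_∞(K)`** for `K ≥ 0` — the finite-volume floor `0 ≤ βΥ_L(K)` (Ginibre, `torusXYStiffness_nonneg`)
passes to the lower envelope. [cite: FisherBarberJasnow1973, §II eqs. (2.4)–(2.5); Ginibre1970 §2 Examples 2 and 4] -/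
theorem torusXYStiffnessLiminf_nonneg (hK : 0 ≤ K) : 0 ≤ torusXYStiffnessLiminf K :=
  le_liminf_of_le (isBoundedUnder_le_torusXYStiffness hK).isCoboundedUnder_ge
    (Eventually.of_forall fun _ => torusXYStiffness_nonneg hK)

/-- An eventual finite-volume ceiling is a ceiling for `Υ_∞` (`K ≥ 0`). [cite: FisherBarberJasnow1973, §II eq. (2.5)] -/
theorem torusXYStiffnessLiminf_le_of_eventually_le (hK : 0 ≤ K) {c : ℝ}
    (h : ∀ᶠ L : ℕ in atTop, torusXYStiffness (L + 1) K ≤ c) : torusXYStiffnessLiminf K ≤ c :=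
  liminf_le_of_frequently_le h.frequently (isBoundedUnder_ge_torusXYStiffness hK)

/-- A finite-volume ceiling valid for all `L ≥ 3` is a ceiling for `Υ_∞` (`K ≥ 0`). [cite: FisherBarberJasnow1973, §II eq. (2.5)] -/
theorem torusXYStiffnessLiminf_le_of_forall_le (hK : 0 ≤ K) {c : ℝ}
    (h : ∀ (L : ℕ) [NeZero L], 3 ≤ L → torusXYStiffness L K ≤ c) : torusXYStiffnessLiminf K ≤ c :=
  torusXYStiffnessLiminf_le_of_eventually_le hK (eventually_three_le_succ.mono fun L hL => h (L + 1) hL)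

/-- **`Υ_∞(K) ≤ K`** — the bare bound `Υ ≤ J` (`torusXYStiffness_le_coupling`). [cite: FisherBarberJasnow1973, §II eqs. (2.4)–(2.5)] -/
theorem torusXYStiffnessLiminf_le_coupling (hK : 0 ≤ K) : torusXYStiffnessLiminf K ≤ K :=
  torusXYStiffnessLiminf_le_of_eventually_le hK (Eventually.of_forall fun _ => torusXYStiffness_le_coupling hK)

/-- **`Υ_∞(K) ≤ 8K²/(1 + 8K)`** for `K > 0` — the energy-renormalised ceiling `torusXYStiffness_le` (f-sum bound ×
Aizenman–Simon equipartition, every `L ≥ 3`). [cite: AizenmanSimon1980LocalWard, eq. (2.4) (equipartition input); FisherBarberJasnow1973 §II] -/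
theorem torusXYStiffnessLiminf_le (hK : 0 < K) : torusXYStiffnessLiminf K ≤ 8 * K ^ 2 / (1 + 8 * K) :=
  torusXYStiffnessLiminf_le_of_forall_le hK.le fun _ _ hL => torusXYStiffness_le hL hK

/-- **The window `0 ≤ Υ_∞(K) ≤ 8K²/(1 + 8K)`** (`K > 0`). [cite: AizenmanSimon1980LocalWard, eq. (2.4); FisherBarberJasnow1973 §II] -/
theorem torusXYStiffnessLiminf_mem_Icc (hK : 0 < K) :
    torusXYStiffnessLiminf K ∈ Set.Icc 0 (8 * K ^ 2 / (1 + 8 * K)) :=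
  ⟨torusXYStiffnessLiminf_nonneg hK.le, torusXYStiffnessLiminf_le hK⟩

/-- **`Υ_∞(K) ≤ K·E^{wired}_3(K)`** for `K ≥ 0` — the wired energy ceiling (`torusXYStiffness_le_mul_wiredPairEnergy`,
every `L ≥ 3`). [cite: FisherBarberJasnow1973, §II eqs. (2.4)–(2.5); GarbanSpencer2022, Appendix Theorem 7.1] -/
theorem torusXYStiffnessLiminf_le_mul_wiredPairEnergy (hK : 0 ≤ K) :
    torusXYStiffnessLiminf K ≤ K * wiredPairEnergy K 3 :=
  torusXYStiffnessLiminf_le_of_forall_le hK fun _ _ hL => torusXYStiffness_le_mul_wiredPairEnergy hL hK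

omit K in
/-- **`Υ_∞(6/7) < 2/π`**: at `T = (7/6)·J` the infinite-volume stiffness is already below the universal-jump value
(`six_sevenths_mul_wiredPairEnergy_lt`, certified decimal). [cite: Nelson2002Defects, §2.2.2 eq. (2.47) (the threshold 2/π); FisherBarberJasnow1973 §II] -/
theorem torusXYStiffnessLiminf_six_sevenths_lt : torusXYStiffnessLiminf (6 / 7) < 2 / Real.pi :=
  (torusXYStiffnessLiminf_le_mul_wiredPairEnergy (by norm_num)).trans_lt six_sevenths_mul_wiredPairEnergy_lt

omit K in
/-- `Υ_∞(0) = 0`. [cite: FisherBarberJasnow1973, §II eqs. (2.4)–(2.5)] -/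
theorem torusXYStiffnessLiminf_zero : torusXYStiffnessLiminf 0 = 0 :=
  le_antisymm (torusXYStiffnessLiminf_le_coupling le_rfl) (torusXYStiffnessLiminf_nonneg le_rfl)

end Bounds

/-! ## §3 (β) `Υ_∞ = 0` throughout the certified high-temperature region -/

section Zero

variable {K : ℝ}

/-- `βΥ_{L+1}(K) → 0 ⇒ Υ_∞(K) = 0`. [cite: FisherBarberJasnow1973, §II eq. (2.5)] -/
theorem torusXYStiffnessLiminf_eq_zero_of_tendsto
    (h : Tendsto (fun L : ℕ => torusXYStiffness (L + 1) K) atTop (𝓝 0)) : torusXYStiffnessLiminf K = 0 :=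
  h.liminf_eq

/-- **A certified box kills `Υ_∞`**: `S_R(K) < 1` for one `R ≥ 1` (`K ≥ 0`) gives `Υ_∞(K) = 0`
(`tendsto_torusXYStiffness_of_nnBoxShellSum_lt_one`). [cite: Lieb1980, Theorem 4 and p. 128 (finite algorithm); FisherBarberJasnow1973 §II] -/
theorem torusXYStiffnessLiminf_eq_zero_of_nnBoxShellSum_lt_one {R : ℕ} (hR : 1 ≤ R) (hK : 0 ≤ K)
    (hS : nnBoxShellSum K 2 R < 1) : torusXYStiffnessLiminf K = 0 :=
  torusXYStiffnessLiminf_eq_zero_of_tendsto (tendsto_torusXYStiffness_of_nnBoxShellSum_lt_one hR hK hS)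

/-- **`Υ_∞(K) = 0` for every `0 ≤ K < 2β_c^{Ising}(2)`** — Aizenman–Simon's window with the true Ising critical
point (`tendsto_torusXYStiffness_of_lt_two_mul_criticalBeta_two`). [cite: AizenmanSimon1980RotorIsing, eq. (2); FisherBarberJasnow1973 §II] -/
theorem torusXYStiffnessLiminf_eq_zero_of_lt_two_mul_criticalBeta_two (hK0 : 0 ≤ K)
    (hK : K < 2 * criticalBeta 2) : torusXYStiffnessLiminf K = 0 :=
  torusXYStiffnessLiminf_eq_zero_of_tendsto (tendsto_torusXYStiffness_of_lt_two_mul_criticalBeta_two hK0 hK)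

/-- **`Υ_∞(K) = 0` for every `0 ≤ K < log(1+√2) ≈ 0.8814`** — the Onsager window
(`tendsto_torusXYStiffness_of_lt_log_one_add_sqrt_two`). [cite: AizenmanSimon1980RotorIsing, eq. (2); FisherBarberJasnow1973 §II] -/
theorem torusXYStiffnessLiminf_eq_zero_of_lt_log_one_add_sqrt_two (hK0 : 0 ≤ K)
    (hK : K < Real.log (1 + Real.sqrt 2)) : torusXYStiffnessLiminf K = 0 :=
  torusXYStiffnessLiminf_eq_zero_of_tendsto (tendsto_torusXYStiffness_of_lt_log_one_add_sqrt_two hK0 hK)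

/-- **`Υ_∞(K) = 0` on Lieb's star** `4u(K) < 1`, `u = I₁/I₀` (`tendsto_torusXYStiffness_lieb`).
[cite: Lieb1980, Theorem 4 (the star); FisherBarberJasnow1973 §II] -/
theorem torusXYStiffnessLiminf_eq_zero_of_four_mul_besselRatio_lt_one (hK : 0 ≤ K)
    (h1 : 4 * besselRatio K < 1) : torusXYStiffnessLiminf K = 0 :=
  torusXYStiffnessLiminf_eq_zero_of_tendsto (tendsto_torusXYStiffness_lieb hK h1)

/-- **A finite free susceptibility kills `Υ_∞`**: `∑_x G_K(0,x) < ∞ ⇒ Υ_∞(K) = 0`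
(`tendsto_torusXYStiffness_of_summable_infTwoPoint`). [cite: Simon1980CMP, Thm 1.3; Lieb1980, p. 128 (boxes)] -/
theorem torusXYStiffnessLiminf_eq_zero_of_summable (hK : 0 ≤ K)
    (hG : Summable fun x : Site 2 => infTwoPoint K 2 0 x) : torusXYStiffnessLiminf K = 0 :=
  torusXYStiffnessLiminf_eq_zero_of_tendsto (tendsto_torusXYStiffness_of_summable_infTwoPoint hK hG)

end Zero

/-! ## §4 (γ) Where `Υ_∞ > 0` the susceptibility is infinite: `T_Υ ≤ T_χ` -/

section Positive

variable {K : ℝ}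

/-- `Υ_∞(K) > 0 ⇒ βΥ_{L+1}(K) ↛ 0`. [cite: FisherBarberJasnow1973, §II eq. (2.5)] -/
theorem not_tendsto_torusXYStiffness_of_torusXYStiffnessLiminf_pos (h : 0 < torusXYStiffnessLiminf K) :
    ¬ Tendsto (fun L : ℕ => torusXYStiffness (L + 1) K) atTop (𝓝 0) :=
  fun ht => h.ne' (torusXYStiffnessLiminf_eq_zero_of_tendsto ht)

/-- **`Υ_∞(K) > 0 ⇒ χ^{2D,free}(K) = ∞`**: the infinite-volume free two-point function `G_K(0,·)` is not summable
(`not_summable_infTwoPoint_of_not_tendsto_torusXYStiffness`, Simon–Lieb) — the stiffness transition lies at or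
below the susceptibility transition, `T_Υ ≤ T_χ`. [cite: Simon1980CMP, Thm 1.3; Lieb1980, p. 128 (boxes)] -/
theorem not_summable_infTwoPoint_of_torusXYStiffnessLiminf_pos (hK : 0 ≤ K) (h : 0 < torusXYStiffnessLiminf K) :
    ¬ Summable fun x : Site 2 => infTwoPoint K 2 0 x :=
  not_summable_infTwoPoint_of_not_tendsto_torusXYStiffness hK
    (not_tendsto_torusXYStiffness_of_torusXYStiffnessLiminf_pos h)

/-- **`Υ_∞(K) > 0 ⇒` Lieb's algorithm never terminates**: `S_R(K) ≥ 1` for every `R ≥ 1`.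
[cite: Lieb1980, Theorem 4 and p. 128 (β ≥ β_c ⇒ φ(β) ≥ 1 for every box)] -/
theorem one_le_nnBoxShellSum_of_torusXYStiffnessLiminf_pos (hK : 0 ≤ K) (h : 0 < torusXYStiffnessLiminf K)
    {R : ℕ} (hR : 1 ≤ R) : 1 ≤ nnBoxShellSum K 2 R :=
  one_le_nnBoxShellSum_of_not_tendsto_torusXYStiffness hK
    (not_tendsto_torusXYStiffness_of_torusXYStiffnessLiminf_pos h) hR

/-- **`Υ_∞(K) > 0 ⇒` every sphere sum of `G_K(0,·)` is at least one** (no decay faster than `1/(8R)` along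
spheres). [cite: Simon1980CMP, Thm 1.3; Lieb1980, p. 128 (boxes)] -/
theorem one_le_sum_sphere_infTwoPoint_of_torusXYStiffnessLiminf_pos (hK : 0 ≤ K)
    (h : 0 < torusXYStiffnessLiminf K) {R : ℕ} (hR : 1 ≤ R) :
    1 ≤ ∑ b ∈ sphere 2 R, infTwoPoint K 2 0 b :=
  one_le_sum_sphere_infTwoPoint_of_not_tendsto hK (not_tendsto_torusXYStiffness_of_torusXYStiffnessLiminf_pos h) hR

/-- **Periodic twin**: `Υ_∞(K) > 0 ⇒` the torus susceptibilities `χ^{per}_L(K)` are unbounded in `L`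
(`torus_susceptibility_unbounded_of_not_tendsto_torusXYStiffness`). [cite: Simon1980CMP, Thm 1.3; Lieb1980, Theorem 4 and p. 128] -/
theorem torus_susceptibility_unbounded_of_torusXYStiffnessLiminf_pos (hK : 0 ≤ K)
    (h : 0 < torusXYStiffnessLiminf K) (B : ℝ) (L₀ : ℕ) :
    ∃ (L : ℕ) (_ : NeZero L), L₀ ≤ L ∧
      B < ∑ y : TorusSite 2 L, (torusXY 2 L).expectJ (fun _ => K) (cosDiff 0 y) :=
  torus_susceptibility_unbounded_of_not_tendsto_torusXYStiffness hK
    (not_tendsto_torusXYStiffness_of_torusXYStiffnessLiminf_pos h) B L₀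

/-- **`Υ_∞(K) > 0 ⇒ K ≥ 2β_c^{Ising}(2)`** (`K ≥ 0`): the stiffness phase lies inside `K ≥ 2β_c(2) ≥ log(1+√2)`.
[cite: AizenmanSimon1980RotorIsing, eq. (2) (β_c^R ≥ 2β_c^I)] -/
theorem two_mul_criticalBeta_two_le_of_torusXYStiffnessLiminf_pos (hK : 0 ≤ K)
    (h : 0 < torusXYStiffnessLiminf K) : 2 * criticalBeta 2 ≤ K := by
  by_contra hlt
  exact h.ne' (torusXYStiffnessLiminf_eq_zero_of_lt_two_mul_criticalBeta_two hK (lt_of_not_ge hlt))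

/-- … in particular `K ≥ log(1+√2)`. [cite: AizenmanSimon1980RotorIsing, eq. (2)] -/
theorem log_one_add_sqrt_two_le_of_torusXYStiffnessLiminf_pos (hK : 0 ≤ K)
    (h : 0 < torusXYStiffnessLiminf K) : Real.log (1 + Real.sqrt 2) ≤ K :=
  log_one_add_sqrt_two_le_two_mul_criticalBeta_two.trans
    (two_mul_criticalBeta_two_le_of_torusXYStiffnessLiminf_pos hK h)

/-- … and outside Lieb's star: `4u(K) ≥ 1`. [cite: Lieb1980, Theorem 4 (the star)] -/
theorem one_le_four_mul_besselRatio_of_torusXYStiffnessLiminf_pos (hK : 0 ≤ K)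
    (h : 0 < torusXYStiffnessLiminf K) : 1 ≤ 4 * besselRatio K := by
  by_contra hlt
  exact h.ne' (torusXYStiffnessLiminf_eq_zero_of_four_mul_besselRatio_lt_one hK (lt_of_not_ge hlt))

end Positive

/-! ## §5 Temperature units: the lower-envelope thermodynamic stiffness `T ↦ T·Υ_∞(J/T)` -/

section Temperature

/-- `0 ≤ T·Υ_∞(J/T)` for `J ≥ 0`, `T > 0`. [cite: FisherBarberJasnow1973, §II eq. (2.5)] -/
theorem mul_torusXYStiffnessLiminf_nonneg {J T : ℝ} (hJ : 0 ≤ J) (hT : 0 < T) :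
    0 ≤ T * torusXYStiffnessLiminf (J / T) :=
  mul_nonneg hT.le (torusXYStiffnessLiminf_nonneg (div_nonneg hJ hT.le))

/-- **`T·Υ_∞(J/T) ≤ 8J²/(T + 8J)`** for `J, T > 0` (the energy-class ceiling in temperature units).
[cite: AizenmanSimon1980LocalWard, eq. (2.4) (equipartition input); FisherBarberJasnow1973 §II] -/
theorem mul_torusXYStiffnessLiminf_le_energy {J T : ℝ} (hJ : 0 < J) (hT : 0 < T) :
    T * torusXYStiffnessLiminf (J / T) ≤ 8 * J ^ 2 / (T + 8 * J) := by
  have hK : 0 < J / T := div_pos hJ hT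
  have h := mul_le_mul_of_nonneg_left (torusXYStiffnessLiminf_le hK) hT.le
  refine h.trans (le_of_eq ?_)
  field_simp

/-- **`T·Υ_∞(J/T) ≤ J·E^{wired}_3(J/T)`** for `J, T > 0` (the wired ceiling in temperature units).
[cite: FisherBarberJasnow1973, §II eqs. (2.4)–(2.5); GarbanSpencer2022, Appendix Theorem 7.1] -/
theorem mul_torusXYStiffnessLiminf_le_wired {J T : ℝ} (hJ : 0 < J) (hT : 0 < T) :
    T * torusXYStiffnessLiminf (J / T) ≤ J * wiredPairEnergy (J / T) 3 := by
  have hK : 0 ≤ J / T := (div_pos hJ hT).le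
  have h := mul_le_mul_of_nonneg_left (torusXYStiffnessLiminf_le_mul_wiredPairEnergy hK) hT.le
  refine h.trans (le_of_eq ?_)
  field_simp

omit [MeasurableSpace Circle] [BorelSpace Circle] in
/-- `J/(2β_c(2)) < T` with `J > 0` puts `K = J/T` in the window `0 ≤ K < 2β_c(2)` (and `T > 0`). [folklore] -/
private theorem coupling_mem_window_liminf {J T : ℝ} (hJ : 0 < J) (hT : J / (2 * criticalBeta 2) < T) :
    0 < T ∧ 0 ≤ J / T ∧ J / T < 2 * criticalBeta 2 := by
  have h2 := two_mul_criticalBeta_two_pos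
  have hT0 : 0 < T := (div_pos hJ h2).trans hT
  refine ⟨hT0, by positivity, ?_⟩
  rw [div_lt_iff₀ hT0]
  rw [div_lt_iff₀ h2] at hT
  linarith

/-- **The lower-envelope thermodynamic stiffness vanishes for `T > J/(2β_c(2)) = ½T_c^{Ising}(ℤ²)`** (`J > 0`):
`T·Υ_∞(J/T) = 0` — no window hypothesis. [cite: AizenmanSimon1980RotorIsing, eq. (2); FisherBarberJasnow1973, eq. (2.5)] -/
theorem mul_torusXYStiffnessLiminf_eq_zero_of_div_two_mul_criticalBeta_two_lt {J T : ℝ} (hJ : 0 < J)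
    (hT : J / (2 * criticalBeta 2) < T) : T * torusXYStiffnessLiminf (J / T) = 0 := by
  obtain ⟨-, hK0, hK⟩ := coupling_mem_window_liminf hJ hT
  rw [torusXYStiffnessLiminf_eq_zero_of_lt_two_mul_criticalBeta_two hK0 hK, mul_zero]

/-- … in particular for `T > J/log(1+√2) ≈ 1.1346·J`. [cite: AizenmanSimon1980RotorIsing, eq. (2)] -/
theorem mul_torusXYStiffnessLiminf_eq_zero_of_div_log_lt {J T : ℝ} (hJ : 0 < J)
    (hT : J / Real.log (1 + Real.sqrt 2) < T) : T * torusXYStiffnessLiminf (J / T) = 0 :=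
  mul_torusXYStiffnessLiminf_eq_zero_of_div_two_mul_criticalBeta_two_lt hJ
    ((div_two_mul_criticalBeta_two_le_div_log hJ.le).trans_lt hT)

end Temperature

/-! ## §6 The Kosterlitz–Thouless corollaries on `Υ_∞` — no finite-volume window hypothesis -/

section KosterlitzThouless

/-- **`T_c ≤ J/(2β_c(2)) = ½T_c^{Ising}(ℤ²)` for every `T_c` below which `Υ_∞ > 0`** (`J > 0`): if
`Υ_∞(J/T) > 0` for all `0 < T < T_c` then `T_c ≤ J/(2β_c(2))` — §3 at any `T ∈ (J/(2β_c(2)), T_c)`. The tree's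
`kt_le_div_two_mul_criticalBeta_two_of_pos_below` without its `L_n → ∞` convergence hypothesis; no universal-jump
input. [cite: AizenmanSimon1980RotorIsing, eq. (2) (k T_c^R/J ≤ 1/(2β_c^I))] -/
theorem kt_le_div_two_mul_criticalBeta_two_of_liminf_pos_below {J Tc : ℝ} (hJ : 0 < J)
    (hpos : ∀ ⦃T : ℝ⦄, 0 < T → T < Tc → 0 < torusXYStiffnessLiminf (J / T)) :
    Tc ≤ J / (2 * criticalBeta 2) := by
  by_contra h
  have hlt : J / (2 * criticalBeta 2) < Tc := lt_of_not_ge h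
  set T : ℝ := (J / (2 * criticalBeta 2) + Tc) / 2 with hTdef
  have hT1 : J / (2 * criticalBeta 2) < T := by rw [hTdef]; linarith
  have hT2 : T < Tc := by rw [hTdef]; linarith
  obtain ⟨hT0, hK0, hK⟩ := coupling_mem_window_liminf hJ hT1
  exact (hpos hT0 hT2).ne' (torusXYStiffnessLiminf_eq_zero_of_lt_two_mul_criticalBeta_two hK0 hK)

/-- … hence **`T_c ≤ J/log(1+√2)`** (`2β_c(2) ≥ log(1+√2)`, `div_two_mul_criticalBeta_two_le_div_log`).
[cite: AizenmanSimon1980RotorIsing, eq. (2) (k T_c^R/J ≤ 1/ln(1+√2) = 1.13)] -/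
theorem kt_le_div_log_one_add_sqrt_two_of_liminf_pos_below {J Tc : ℝ} (hJ : 0 < J)
    (hpos : ∀ ⦃T : ℝ⦄, 0 < T → T < Tc → 0 < torusXYStiffnessLiminf (J / T)) :
    Tc ≤ J / Real.log (1 + Real.sqrt 2) :=
  (kt_le_div_two_mul_criticalBeta_two_of_liminf_pos_below hJ hpos).trans
    (div_two_mul_criticalBeta_two_le_div_log hJ.le)

/-- … and the decimal **`T_c ≤ 1.1346·J`** (`inv_log_one_add_sqrt_two_lt`). [cite: AizenmanSimon1980RotorIsing, eq. (2) (k T_c^R/J ≤ 1.13)] -/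
theorem kt_le_decimal_of_liminf_pos_below {J Tc : ℝ} (hJ : 0 < J)
    (hpos : ∀ ⦃T : ℝ⦄, 0 < T → T < Tc → 0 < torusXYStiffnessLiminf (J / T)) :
    Tc ≤ 11346 / 10000 * J := by
  refine (kt_le_div_log_one_add_sqrt_two_of_liminf_pos_below hJ hpos).trans ?_
  have h := inv_log_one_add_sqrt_two_lt
  rw [div_eq_mul_one_div]
  exact (mul_le_mul_of_nonneg_left h.le hJ.le).trans_eq (by ring)

/-- The profile `T ↦ T·Υ_∞(J/T)` is positive exactly where `Υ_∞(J/T)` is (`T > 0`). [folklore] -/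
private theorem liminf_pos_of_mul_pos {J T : ℝ} (hT : 0 < T) (h : 0 < T * torusXYStiffnessLiminf (J / T)) :
    0 < torusXYStiffnessLiminf (J / T) :=
  pos_of_mul_pos_right h hT.le

/-- **Instance: a stiffness transition of the lower-envelope profile** (`IsTransitionAt (T ↦ T·Υ_∞(J/T)) T_c` in the
sense of the T1 file: positive on `(0, T_c)`, zero above) has `T_c ≤ J/(2β_c(2))` — no window hypothesis, no
universal-jump input. [cite: AizenmanSimon1980RotorIsing, eq. (2)] -/
theorem kt_le_div_two_mul_criticalBeta_two_of_isTransitionAt_liminf {J Tc : ℝ} (hJ : 0 < J)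
    (htr : IsTransitionAt (fun T => T * torusXYStiffnessLiminf (J / T)) Tc) :
    Tc ≤ J / (2 * criticalBeta 2) :=
  kt_le_div_two_mul_criticalBeta_two_of_liminf_pos_below hJ fun _ hT hTTc =>
    liminf_pos_of_mul_pos hT (htr.1 hT hTTc)

/-- **Instance: under the stability inequality for the lower-envelope profile** (`StableBelow (T ↦ T·Υ_∞(J/T)) T_c`,
of which only positivity below `T_c` is used) the same `T_c ≤ J/(2β_c(2))` — inside Aizenman–Simon's window the K2
input is idle. [cite: AizenmanSimon1980RotorIsing, eq. (2); Nelson2002Defects, §2.2.2 eq. (2.47) (stability inequality, as hypothesis)] -/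
theorem kt_le_div_two_mul_criticalBeta_two_of_stableBelow_liminf {J Tc : ℝ} (hJ : 0 < J)
    (hst : StableBelow (fun T => T * torusXYStiffnessLiminf (J / T)) Tc) :
    Tc ≤ J / (2 * criticalBeta 2) :=
  kt_le_div_two_mul_criticalBeta_two_of_liminf_pos_below hJ fun _ hT hTTc =>
    liminf_pos_of_mul_pos hT (hst.pos hT hTTc)

/-- **Energy-renormalised Kosterlitz–Thouless bound on `Υ_∞`**: `StableBelow (T ↦ T·Υ_∞(J/T)) T_c` with `T_c > 0`,
`J > 0` gives **`T_c ≤ (√(16 + 4π) − 4)·J ≈ 1.3448·J`** — the tree's `kt_le_of_stableBelow_of_energyCeiling` fed with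
the ceiling `T·Υ_∞(J/T) ≤ 8J²/(T + 8J)` of §5; no window hypothesis.
[cite: Nelson2002Defects, §2.2.2 eqs. (2.44)–(2.47) (stability inequality, consumed as hypothesis)] -/
theorem kt_le_energy_of_stableBelow_liminf {J Tc : ℝ} (hJ : 0 < J) (hTc : 0 < Tc)
    (hst : StableBelow (fun T => T * torusXYStiffnessLiminf (J / T)) Tc) :
    Tc ≤ (Real.sqrt (16 + 4 * Real.pi) - 4) * J :=
  kt_le_of_stableBelow_of_energyCeiling hJ hTc hst fun _ hT _ => mul_torusXYStiffnessLiminf_le_energy hJ hT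

/-- **`T_c ≤ (7/6)·J` on `Υ_∞`**: `StableBelow (T ↦ T·Υ_∞(J/T)) T_c`, `T_c > 0`, `J > 0` give `T_c ≤ (7/6)·J` — the
tree's `kt_le_seven_sixths_of_stableBelow_of_wiredCeiling` fed with the wired ceiling of §5; equivalently: at
`T = (7/6)·J` one has `Υ_∞(6/7) < 2/π` (`torusXYStiffnessLiminf_six_sevenths_lt`), contradicting `βΥ ≥ 2/π`.
No window hypothesis. [cite: Nelson2002Defects, §2.2.2 eqs. (2.44)–(2.47) (stability inequality, consumed as hypothesis); Ginibre1970, Model 3 p. 322] -/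
theorem kt_le_seven_sixths_of_stableBelow_liminf {J Tc : ℝ} (hJ : 0 < J) (hTc : 0 < Tc)
    (hst : StableBelow (fun T => T * torusXYStiffnessLiminf (J / T)) Tc) : Tc ≤ 7 / 6 * J :=
  kt_le_seven_sixths_of_stableBelow_of_wiredCeiling hJ hTc hst fun _ hT _ =>
    mul_torusXYStiffnessLiminf_le_wired hJ hT

end KosterlitzThouless

/-! ## §7 (δ) The cell's stiffness sentences as predicates on `Υ_∞` (statement shapes; asserted nowhere) -/

section Typing

/-- **Crux №2's stiffness-class decay sentence `(S_Υ)` on `Υ_∞`** at coupling `K`: IF `Υ_∞(K) > 0` then the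
infinite-volume free two-point function decays at least as the power `1/(2π Υ_∞(K))` of the distance,
`G_K(x, y) ≤ C (1 + ‖x − y‖_∞)^{−1/(2π Υ_∞(K))}` for some constant `C` and all `x, y ∈ ℤ²` — McBryan–Spencer's
bound with the STIFFNESS in place of the bare coupling in the exponent. A PREDICATE (the statement shape of the
classical warm-up of crux №2; proved in print for no `K`, asserted nowhere in the tree). Wherever `Υ_∞(K) = 0` it
holds vacuously (`stiffnessClassDecayOnLiminf_of_eq_zero`) — exactly the region where the tree REFUTES the
finite-volume `Υ_L`-in-the-exponent form (`torusXY_not_uniform_decay_stiffnessExponent`) — so this form needs no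
window hypothesis. [cite: McBryanSpencer1977, main theorem (form of the bound, bare exponent 1/(2πβJ))] -/
def StiffnessClassDecayOnLiminf (K : ℝ) : Prop :=
  0 < torusXYStiffnessLiminf K →
    ∃ C : ℝ, ∀ x y : Site 2,
      infTwoPoint K 2 x y ≤ C * (1 + (Site.supNorm (x - y) : ℝ)) ^ (-(1 / (2 * Real.pi * torusXYStiffnessLiminf K)))

/-- `(S_Υ)` on `Υ_∞` is vacuous where `Υ_∞(K) = 0`. [cite: McBryanSpencer1977, main theorem (form of the bound)] -/
theorem stiffnessClassDecayOnLiminf_of_eq_zero {K : ℝ} (h : torusXYStiffnessLiminf K = 0) :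
    StiffnessClassDecayOnLiminf K := fun hpos => absurd h hpos.ne'

/-- `(S_Υ)` on `Υ_∞` HOLDS (vacuously) for every `0 ≤ K < 2β_c(2)` — in particular throughout the Onsager window and
on Lieb's star, where the finite-volume form is refuted. [cite: AizenmanSimon1980RotorIsing, eq. (2); McBryanSpencer1977, main theorem (form)] -/
theorem stiffnessClassDecayOnLiminf_of_lt_two_mul_criticalBeta_two {K : ℝ} (hK0 : 0 ≤ K)
    (hK : K < 2 * criticalBeta 2) : StiffnessClassDecayOnLiminf K :=
  stiffnessClassDecayOnLiminf_of_eq_zero (torusXYStiffnessLiminf_eq_zero_of_lt_two_mul_criticalBeta_two hK0 hK)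

/-- `(S_Υ)` on `Υ_∞` holds (vacuously) on Lieb's star `4u(K) < 1` — where `torusXY_not_uniform_decay_stiffnessExponent`
refutes the `Υ_L` form. [cite: Lieb1980, Theorem 4 (the star); McBryanSpencer1977, main theorem (form)] -/
theorem stiffnessClassDecayOnLiminf_of_four_mul_besselRatio_lt_one {K : ℝ} (hK : 0 ≤ K)
    (h1 : 4 * besselRatio K < 1) : StiffnessClassDecayOnLiminf K :=
  stiffnessClassDecayOnLiminf_of_eq_zero (torusXYStiffnessLiminf_eq_zero_of_four_mul_besselRatio_lt_one hK h1)

/-- Where `Υ_∞(K) > 0` the `(S_Υ)` exponent dominates McBryan–Spencer's: `1/(2πK) ≤ 1/(2π Υ_∞(K))` (`Υ_∞ ≤ K`), i.e.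
the stiffness-class sentence is the STRONGER decay statement. [cite: McBryanSpencer1977, main theorem (bare exponent 1/(2πβJ))] -/
theorem spinWave_exponent_le_stiffness_exponent {K : ℝ} (hK : 0 ≤ K) (h : 0 < torusXYStiffnessLiminf K) :
    1 / (2 * Real.pi * K) ≤ 1 / (2 * Real.pi * torusXYStiffnessLiminf K) := by
  have hΥK := torusXYStiffnessLiminf_le_coupling hK
  have hπ := Real.pi_pos
  exact one_div_le_one_div_of_le (by positivity) (by nlinarith)

/-- **K2's Nelson–Kosterlitz sentence on `Υ_∞`** for the comparison model with coupling `J` and candidate transition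
temperature `T_c`: the Kosterlitz–Thouless stability inequality for the lower-envelope thermodynamic stiffness,
`(2/π)·T ≤ T·Υ_∞(J/T)` for all `0 < T < T_c` — literally the T1 file's `StableBelow` applied to the profile
`T ↦ T·Υ_∞(J/T)`; equivalently `βΥ_∞ ≥ 2/π` below `T_c` (`nelsonKosterlitzOnLiminf_iff`). A PREDICATE (the
renormalisation-group HYPOTHESIS of the K2 register, consumed only as a hypothesis; asserted nowhere). Its kernel
consequences: `T_c ≤ (7/6)·J`, `T_c ≤ 1.3448·J`, `T_c ≤ J/(2β_c(2))` (§6). The universal-jump EQUALITY reads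
`UniversalJumpAt (T ↦ T·Υ_∞(J/T)) T_c`. [cite: Nelson2002Defects, §2.2.2 eqs. (2.44)–(2.47) (stability inequality K ≥ 2/π)] -/
def NelsonKosterlitzOnLiminf (J Tc : ℝ) : Prop :=
  StableBelow (fun T => T * torusXYStiffnessLiminf (J / T)) Tc

/-- The dimensionless reading: `NelsonKosterlitzOnLiminf J T_c ↔ ∀ 0 < T < T_c, 2/π ≤ Υ_∞(J/T)`.
[cite: Nelson2002Defects, §2.2.2 eq. (2.47) (K ≥ 2/π)] -/
theorem nelsonKosterlitzOnLiminf_iff {J Tc : ℝ} :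
    NelsonKosterlitzOnLiminf J Tc ↔ ∀ ⦃T : ℝ⦄, 0 < T → T < Tc → 2 / Real.pi ≤ torusXYStiffnessLiminf (J / T) := by
  unfold NelsonKosterlitzOnLiminf StableBelow
  constructor
  · intro h T hT hTTc
    have h1 : 2 / Real.pi * T ≤ T * torusXYStiffnessLiminf (J / T) := h hT hTTc
    rw [mul_comm] at h1
    exact le_of_mul_le_mul_left h1 hT
  · intro h T hT hTTc
    have h1 := mul_le_mul_of_nonneg_left (h hT hTTc) hT.le
    rw [mul_comm]
    exact h1

/-- Under K2 on `Υ_∞`: **`T_c ≤ (7/6)·J`** (`J, T_c > 0`). [cite: Nelson2002Defects, §2.2.2 eqs. (2.44)–(2.47) (stability inequality, consumed as hypothesis)] -/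
theorem NelsonKosterlitzOnLiminf.kt_le_seven_sixths {J Tc : ℝ} (h : NelsonKosterlitzOnLiminf J Tc) (hJ : 0 < J)
    (hTc : 0 < Tc) : Tc ≤ 7 / 6 * J :=
  kt_le_seven_sixths_of_stableBelow_liminf hJ hTc h

/-- Under K2 on `Υ_∞`: **`T_c ≤ (√(16 + 4π) − 4)·J`**. [cite: Nelson2002Defects, §2.2.2 eqs. (2.44)–(2.47) (stability inequality, consumed as hypothesis)] -/
theorem NelsonKosterlitzOnLiminf.kt_le_energy {J Tc : ℝ} (h : NelsonKosterlitzOnLiminf J Tc) (hJ : 0 < J)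
    (hTc : 0 < Tc) : Tc ≤ (Real.sqrt (16 + 4 * Real.pi) - 4) * J :=
  kt_le_energy_of_stableBelow_liminf hJ hTc h

/-- Under K2 on `Υ_∞` (only positivity used): **`T_c ≤ J/(2β_c(2))`**. [cite: AizenmanSimon1980RotorIsing, eq. (2); Nelson2002Defects, §2.2.2 eq. (2.47)] -/
theorem NelsonKosterlitzOnLiminf.kt_le_div_two_mul_criticalBeta_two {J Tc : ℝ} (h : NelsonKosterlitzOnLiminf J Tc)
    (hJ : 0 < J) : Tc ≤ J / (2 * criticalBeta 2) :=
  kt_le_div_two_mul_criticalBeta_two_of_stableBelow_liminf hJ h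

/-- K2 on `Υ_∞` is incompatible with any `T_c > (7/6)·J`: at `T = (7/6)·J < T_c` it would demand
`Υ_∞(6/7) ≥ 2/π`, against the certified `Υ_∞(6/7) < 2/π`. [cite: Nelson2002Defects, §2.2.2 eq. (2.47) (K ≥ 2/π); FisherBarberJasnow1973 §II] -/
theorem not_nelsonKosterlitzOnLiminf_of_seven_sixths_lt {J Tc : ℝ} (hJ : 0 < J) (hTc : 7 / 6 * J < Tc) :
    ¬ NelsonKosterlitzOnLiminf J Tc := fun h =>
  absurd (h.kt_le_seven_sixths hJ (lt_trans (by positivity) hTc)) (not_le.2 hTc)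

end Typing

end Literature.Probability.LatticeModels

end
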